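import Mathlib
import Summits.AnomalousDissipation.AnomalousDissipation.Theorems.SoloBlindGPUniqueness

/-!
# Positivity cannot be lost along a branch (discrete strong maximum principle)

Solo-blind paper §24.17(7)(h) and TOY VERDICT (2): along a continuous branch of solutions of the
scaled pattern equation `ε² A″ + (b − T[A²]) A = 0`, a positive solution can stop being positive only
by vanishing identically, because a nonnegative solution of the LINEAR equation
`ε² ΔA + V·A = 0` with one zero is zero (its neighbours must cancel, and they are nonnegative).
Together with uniqueness and non-degeneracy (files `SoloBlindGPUniqueness`, `SoloBlindGPNondegenerate`)
this is what makes the positive pattern persist under continuation in every parameter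
(ε, the smoothing width w, the skew part of T).  Discrete kernel on the cycle `ZMod N`.
-/

namespace Summit.AnomalousDissipation.AnomalousDissipation.Theorems

/-- One step of the discrete maximum principle: a nonnegative solution of `ε² lapZ A + V A = 0`
vanishing at `i` vanishes at both neighbours of `i`. -/
lemma neighbours_zero_of_zero {N : ℕ} (ε : ℝ) (hε : ε ≠ 0) (V A : ZMod N → ℝ)
    (hA : ∀ i, 0 ≤ A i) (heq : ∀ i, ε ^ 2 * lapZ A i + V i * A i = 0) (i : ZMod N)
    (hi : A i = 0) : A (i + 1) = 0 ∧ A (i - 1) = 0 := by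
  have h := heq i
  rw [hi, mul_zero, add_zero, lapZ, hi, mul_zero, sub_zero] at h
  have hε2 : ε ^ 2 ≠ 0 := pow_ne_zero 2 hε
  have hsum : A (i + 1) + A (i - 1) = 0 := by
    rcases mul_eq_zero.mp h with h | h
    · exact absurd h hε2
    · exact h
  have h1 := hA (i + 1); have h2 := hA (i - 1)
  constructor <;> linarith

/-- Propagation: if `A i₀ = 0` then `A (i₀ + k) = 0` for every natural `k`. -/
lemma zero_propagates {N : ℕ} (ε : ℝ) (hε : ε ≠ 0) (V A : ZMod N → ℝ)
    (hA : ∀ i, 0 ≤ A i) (heq : ∀ i, ε ^ 2 * lapZ A i + V i * A i = 0) (i₀ : ZMod N)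
    (hi : A i₀ = 0) (k : ℕ) : A (i₀ + k) = 0 := by
  induction k with
  | zero => simpa using hi
  | succ k ih =>
    have := (neighbours_zero_of_zero ε hε V A hA heq (i₀ + k) ih).1
    simpa [Nat.cast_succ, add_assoc] using this

/-- **Positivity persistence (discrete strong maximum principle).** A nonnegative solution of
`ε² lapZ A + V A = 0` on the cycle is either everywhere positive or identically zero. -/
theorem nonneg_solution_dichotomy {N : ℕ} [NeZero N] (ε : ℝ) (hε : ε ≠ 0) (V A : ZMod N → ℝ)
    (hA : ∀ i, 0 ≤ A i) (heq : ∀ i, ε ^ 2 * lapZ A i + V i * A i = 0) :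
    (∀ i, 0 < A i) ∨ (∀ i, A i = 0) := by
  by_cases h : ∃ i₀, A i₀ = 0
  · right
    obtain ⟨i₀, hi⟩ := h
    intro i
    have := zero_propagates ε hε V A hA heq i₀ hi (i - i₀).val
    rwa [ZMod.natCast_zmod_val, add_sub_cancel] at this
  · left
    exact fun i => lt_of_le_of_ne (hA i) (fun h' => h ⟨i, h'.symm⟩)

/-- The form used for the pattern equation: with `V = b − T[A²]` (any operator `T`), a nonnegative
GP solution that is not identically zero is strictly positive — so along a continuous branch the
positive solution of `SoloBlindGPUniqueness.IsGPSolution` type can only cease to be positive by collapsing to zero. -/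
theorem gp_nonneg_solution_pos {N : ℕ} [NeZero N] (T : Matrix (ZMod N) (ZMod N) ℝ) (b : ZMod N → ℝ)
    (ε : ℝ) (hε : ε ≠ 0) (A : ZMod N → ℝ) (hA : ∀ i, 0 ≤ A i)
    (heq : ∀ i, ε ^ 2 * lapZ A i + b i * A i - A i * (T.mulVec (fun j => A j ^ 2)) i = 0)
    (hne : ∃ i, A i ≠ 0) : ∀ i, 0 < A i := by
  have heq' : ∀ i, ε ^ 2 * lapZ A i + (b i - (T.mulVec (fun j => A j ^ 2)) i) * A i = 0 := by
    intro i; have := heq i; linarith [this]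
  rcases nonneg_solution_dichotomy ε hε _ A hA heq' with h | h
  · exact h
  · obtain ⟨i, hi⟩ := hne; exact absurd (h i) hi

end Summit.AnomalousDissipation.AnomalousDissipation.Theorems
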